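import Mathlib
import HarnessLib
import Summits.HubbardSuperconductivity.HubbardSuperconductivity.Theorems.KLProgrammeKLRegimeWickBubbleChannels

/-!
# Route `KLProgramme` — ENGINE child (stmt-HubbardSuperconductivity-19918 `KLRegimeEngineV14` / its gen-6 successor), stub `stub_engine_step_values`,
# conjunct (E2-v9): the ONE-LINE Wick term = EXTERNAL-LEG DRESSING by the Wick self-energy, exactly
# (E2-WICK-ROADMAP §5 (iii-e); cell gate-hubbard-kl, seat p1 g9; sequel to `…WickBubbleChannels` / `…WickStepLines`)

The `j = 1` term of `klw_wickPairAmplitude_succ_lines` is the fold of the SINGLE cross contraction `Δ_×(C)(𝒲_n⁰·𝒲_n¹)` (`C = D_n − D_{n+1} = g_{n+1}`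
by linearity).  By `grassmannLaplacian_crossCov_copy_mul_copy` (p483614) `Δ_×(C)(a⁰·b¹) = Σ_{X,Y} contr C X Y • (involute ∂_X a)⁰·(∂_Y b)¹`; its `4`-leg kernel
(`kernel_dblFold`, `sum_colourings_four`) has the eight colourings with an ODD number of legs on each copy (`1+3`, `3+1`; the other eight vanish for
`b` even: copy-`1` sign flip, the copy-`1` factor `∂_Y b` is odd), each a `𝒲₂ ⊗ 𝒲₄` graph: a two-leg vertex on one external leg joined by the line
to the four-leg vertex.

* §1 (generic) the sorted colourings `kernel_oneLine_sorted13/31` (`= −2·Σ contr C X Y·kernel a 2 (X,A)·kernel b 4 (Y,B₀,B₁,B₂)` and its mirror), the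
  eight colourings with their signs (`(−1)^i` for the leg `i` alone on copy `0`, `(−1)^{i+1}` alone on copy `1`), the vanishing of the other eight,
  **`kernel_dblFold_oneLine_self`**: for `a = b = w` even,
  `kernel (dblFold(Δ_×(C)(w⁰w¹))) 4 Z = 4·(−T₀ + T₁ − T₂ + T₃)`, `T_i = Σ_{X,Y} contr C X Y · kernel w 2 (X, Z_i) · kernel w 4 (Y, Z with Z_i removed)`;
* §2 (model) for a DIAGONAL line (`contr ℂ C = diagContr ℓ`) and `w = 𝒲_n`: the two-leg kernel forces `X` = the reciprocal of `Z_i`, so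
  `T_i = ℓ(p_i)·kernel 𝒲_n 2 (ψ̂⁻_{p_iσ_i}, ψ̂⁺_{p_iσ_i})·(−1)^i·kernel 𝒲_n 4 Z` for EITHER charge of the leg `Z_i = ψ̂^±_{p_iσ_i}`, whence
  **`vertexFn_dblFold_oneLine`** — for ANY four external legs `Z`:
  `𝒱₄(dblFold(Δ_×(C)(𝒲_n⁰·𝒲_n¹)))(Z) = 2·(βL²)⁻¹ · 𝒱₄(𝒲_n)(Z) · Σ_{i<4} ℓ(p_i)·Σ^W_n(p_i,σ_i)` (`Σ^W = klWickSelfEnergy`):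
  each external leg is dressed by (line value) × (Wick self-energy) at its own frequency–momentum — the `legDressBarQ·legSliceCountT` line of
  (E2-v9) (with the slice line `ℓ_g` only legs on the slice support count), EXACT.

Proved; no definitions; exact identities; nothing about sizes is asserted.
-/

noncomputable section

namespace Summit.HubbardSuperconductivity.HubbardSuperconductivity.Theorems.KLRegimeWick

set_option linter.dupNamespace false -- summit = problem name (single-conjunct summit), D-0017

open Literature.MathematicalPhysics.QuantumLattice GrassmannAlgebra Finset Matrix
open Literature.Probability.LatticeModels
open Summit.HubbardSuperconductivity.HubbardSuperconductivity.Theorems.TwoPointAssembly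
open Summit.HubbardSuperconductivity.HubbardSuperconductivity.Theorems.KLProgrammeLegKernels
open Summit.HubbardSuperconductivity.HubbardSuperconductivity.Theorems.KLRegimeSplit

/-! ## §1 (generic) the eight odd colourings of the one-line term and their sum -/

section Generic

variable (R : Type*) [CommRing R] [Algebra ℚ R] {Γ : Type*} [Fintype Γ] [DecidableEq Γ]

/-- A two-copy product with an ODD copy-`1` factor has no kernel with an EVEN number of copy-`1` legs. -/
theorem kernel_copy_mul_copy_eq_zero_of_even (x : GrassmannAlgebra R Γ) {y : GrassmannAlgebra R Γ} (hy : y ∈ evenOdd R 1) {m : ℕ}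
    (W : Fin m → Γ × Fin 2) (hW : ∏ i, (if (W i).2 = 1 then (-1 : R) else 1) = 1) :
    kernel R (dblCopy R 0 x * dblCopy R 1 y) m W = 0 := by
  have hF : ExteriorAlgebra.map (LinearMap.mulLeft R (fun q : Γ × Fin 2 => if q.2 = 1 then (-1 : R) else 1))
      (dblCopy R 0 x * dblCopy R 1 y) = -(dblCopy R 0 x * dblCopy R 1 y) := by
    rw [map_mul, map_copySign_dblCopy_zero, map_copySign_dblCopy_one, CliffordAlgebra.involute_eq_of_mem_odd hy, map_neg, mul_neg]
  have h := kernel_map_mulLeft R (fun q : Γ × Fin 2 => if q.2 = 1 then (-1 : R) else 1) (dblCopy R 0 x * dblCopy R 1 y) m W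
  rw [hF, kernel_neg, hW, one_mul] at h
  have h2 : ((Nat.factorial 2 : ℕ) : R) * kernel R (dblCopy R 0 x * dblCopy R 1 y) m W = 0 := by
    rw [Nat.factorial_two, Nat.cast_ofNat, two_mul]
    nth_rewrite 1 [← h]
    rw [neg_add_cancel]
  exact (isUnit_factorial R 2).mul_right_eq_zero.1 h2

omit [Fintype Γ] [DecidableEq Γ] [Algebra ℚ R] in
/-- A derivative of an even element is odd. -/
theorem grassmannDeriv_mem_evenOdd_one_of_zero (Y : Γ) {b : GrassmannAlgebra R Γ} (hb : b ∈ evenOdd R 0) :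
    grassmannDeriv R Y b ∈ evenOdd R 1 := by
  have h := grassmannDeriv_mem_evenOdd R Y hb
  rwa [zero_add] at h

/-- **The one-line term has no kernel at a colouring with an even number of copy-`1` legs** (`b` even). -/
theorem kernel_oneLine_eq_zero_of_even (C : Matrix Γ Γ R) (a : GrassmannAlgebra R Γ) {b : GrassmannAlgebra R Γ} (hb : b ∈ evenOdd R 0)
    {m : ℕ} (W : Fin m → Γ × Fin 2) (hW : ∏ i, (if (W i).2 = 1 then (-1 : R) else 1) = 1) :
    kernel R (grassmannLaplacian R (crossCov R C) (dblCopy R 0 a * dblCopy R 1 b)) m W = 0 := by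
  rw [grassmannLaplacian_crossCov_copy_mul_copy]
  simp only [kernel_finset_sum, kernel_smul]
  refine Finset.sum_eq_zero fun X _ => Finset.sum_eq_zero fun Y _ => ?_
  rw [kernel_copy_mul_copy_eq_zero_of_even R _ (grassmannDeriv_mem_evenOdd_one_of_zero R Y hb) W hW, mul_zero]

omit [Fintype Γ] [DecidableEq Γ] in
/-- `constPart (∂_A (involute (∂_X a))) = −2!·kernel a 2 (X, A)`. -/
theorem constPart_deriv_involute_deriv (A X : Γ) (a : GrassmannAlgebra R Γ) :
    constPart R (grassmannDeriv R A (CliffordAlgebra.involute (grassmannDeriv R X a))) = -((Nat.factorial 2 : R) * kernel R a 2 ![X, A]) := by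
  rw [grassmannDeriv_involute, map_neg, constPart_involute, constPart_deriv_deriv]

omit [Fintype Γ] [DecidableEq Γ] in
/-- `constPart (∂_{[A₀,A₁,A₂]} (involute (∂_X a))) = −4!·kernel a 4 (X, A₀, A₁, A₂)`. -/
theorem constPart_iterDeriv_three_involute_deriv (A₀ A₁ A₂ X : Γ) (a : GrassmannAlgebra R Γ) :
    constPart R (iterDeriv R ![A₀, A₁, A₂] (CliffordAlgebra.involute (grassmannDeriv R X a))) =
      -((Nat.factorial 4 : R) * kernel R a 4 ![X, A₀, A₁, A₂]) := by
  rw [iterDeriv_involute, map_smul, constPart_involute, smul_eq_mul, factorial_mul_kernel, iterDeriv_succ_apply R ![X, A₀, A₁, A₂]]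
  have h : (fun j : Fin 3 => (![X, A₀, A₁, A₂] : Fin 4 → Γ) j.succ) = ![A₀, A₁, A₂] := by funext j; fin_cases j <;> rfl
  rw [h]
  norm_num

omit [Fintype Γ] [DecidableEq Γ] in
/-- `constPart (∂_{[B₀,B₁,B₂]} (∂_Y b)) = 4!·kernel b 4 (Y, B₀, B₁, B₂)`. -/
theorem constPart_iterDeriv_three_deriv (B₀ B₁ B₂ Y : Γ) (b : GrassmannAlgebra R Γ) :
    constPart R (iterDeriv R ![B₀, B₁, B₂] (grassmannDeriv R Y b)) = (Nat.factorial 4 : R) * kernel R b 4 ![Y, B₀, B₁, B₂] := by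
  rw [factorial_mul_kernel, iterDeriv_succ_apply R ![Y, B₀, B₁, B₂]]
  have h : (fun j : Fin 3 => (![Y, B₀, B₁, B₂] : Fin 4 → Γ) j.succ) = ![B₀, B₁, B₂] := by funext j; fin_cases j <;> rfl
  rw [h]
  rfl

/-- **Sorted colouring `1+3`** (leg `A` on copy `0` = `a`, legs `B₀,B₁,B₂` on copy `1` = `b`):
`kernel (Δ_×(C)(a⁰b¹)) 4 ((A,0),(B₀,1),(B₁,1),(B₂,1)) = −2·Σ_{X,Y} contr C X Y · kernel a 2 (X,A) · kernel b 4 (Y,B₀,B₁,B₂)`. -/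
theorem kernel_oneLine_sorted13 (C : Matrix Γ Γ R) (a b : GrassmannAlgebra R Γ) (A B₀ B₁ B₂ : Γ) :
    kernel R (grassmannLaplacian R (crossCov R C) (dblCopy R 0 a * dblCopy R 1 b)) 4 ![(A, (0 : Fin 2)), (B₀, 1), (B₁, 1), (B₂, 1)] =
      -(2 * ∑ X, ∑ Y, contr R C X Y * (kernel R a 2 ![X, A] * kernel R b 4 ![Y, B₀, B₁, B₂])) := by
  refine (isUnit_factorial R 4).mul_right_inj.1 ?_
  rw [factorial_mul_kernel, grassmannLaplacian_crossCov_copy_mul_copy]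
  simp only [map_sum, map_smul, smul_eq_mul]
  have key : ∀ X Y : Γ, constPart R (iterDeriv R ![(A, (0 : Fin 2)), (B₀, 1), (B₁, 1), (B₂, 1)]
      (dblCopy R 0 (CliffordAlgebra.involute (grassmannDeriv R X a)) * dblCopy R 1 (grassmannDeriv R Y b))) =
      -((Nat.factorial 2 : R) * kernel R a 2 ![X, A]) * ((Nat.factorial 4 : R) * kernel R b 4 ![Y, B₀, B₁, B₂]) := by
    intro X Y
    have h := constPart_iterDeriv_copyZero_copyOne R (m₀ := 1) (m₁ := 3) ![A] ![B₀, B₁, B₂]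
      (CliffordAlgebra.involute (grassmannDeriv R X a)) (grassmannDeriv R Y b)
    have e : iterDeriv R ![(A, (0 : Fin 2)), (B₀, 1), (B₁, 1), (B₂, 1)] =
        (iterDeriv R (fun i : Fin 3 => ((![B₀, B₁, B₂] : Fin 3 → Γ) i, (1 : Fin 2)))) ∘ₗ
          iterDeriv R (fun i : Fin 1 => ((![A] : Fin 1 → Γ) i, (0 : Fin 2))) := by
      apply LinearMap.ext
      intro P
      rw [LinearMap.comp_apply, iterDeriv_succ_apply R ![(A, (0 : Fin 2)), (B₀, 1), (B₁, 1), (B₂, 1)],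
        iterDeriv_succ_apply R (fun i : Fin 1 => ((![A] : Fin 1 → Γ) i, (0 : Fin 2))), iterDeriv_zero_apply]
      have h3 : (fun j : Fin 3 => (![(A, (0 : Fin 2)), (B₀, 1), (B₁, 1), (B₂, 1)] : Fin 4 → Γ × Fin 2) j.succ) =
          fun i : Fin 3 => ((![B₀, B₁, B₂] : Fin 3 → Γ) i, (1 : Fin 2)) := by funext j; fin_cases j <;> rfl
      rw [h3]
      rfl
    rw [e, LinearMap.comp_apply, h, constPart_iterDeriv_three_deriv]
    rw [show iterDeriv R ![A] (CliffordAlgebra.involute (grassmannDeriv R X a)) =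
        grassmannDeriv R A (CliffordAlgebra.involute (grassmannDeriv R X a)) from by rw [iterDeriv_succ_apply, iterDeriv_zero_apply]; rfl,
      constPart_deriv_involute_deriv]
  simp only [key]
  rw [mul_neg, eq_neg_iff_add_eq_zero]
  simp only [Finset.mul_sum, ← Finset.sum_add_distrib]
  refine Finset.sum_eq_zero fun X _ => Finset.sum_eq_zero fun Y _ => ?_
  simp only [Nat.factorial]
  push_cast
  ring

/-- **Sorted colouring `3+1`** (legs `A₀,A₁,A₂` on copy `0` = `a`, leg `B` on copy `1` = `b`):
`kernel (Δ_×(C)(a⁰b¹)) 4 ((A₀,0),(A₁,0),(A₂,0),(B,1)) = −2·Σ_{X,Y} contr C X Y · kernel a 4 (X,A₀,A₁,A₂) · kernel b 2 (Y,B)`. -/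
theorem kernel_oneLine_sorted31 (C : Matrix Γ Γ R) (a b : GrassmannAlgebra R Γ) (A₀ A₁ A₂ B : Γ) :
    kernel R (grassmannLaplacian R (crossCov R C) (dblCopy R 0 a * dblCopy R 1 b)) 4 ![(A₀, (0 : Fin 2)), (A₁, 0), (A₂, 0), (B, 1)] =
      -(2 * ∑ X, ∑ Y, contr R C X Y * (kernel R a 4 ![X, A₀, A₁, A₂] * kernel R b 2 ![Y, B])) := by
  refine (isUnit_factorial R 4).mul_right_inj.1 ?_
  rw [factorial_mul_kernel, grassmannLaplacian_crossCov_copy_mul_copy]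
  simp only [map_sum, map_smul, smul_eq_mul]
  have key : ∀ X Y : Γ, constPart R (iterDeriv R ![(A₀, (0 : Fin 2)), (A₁, 0), (A₂, 0), (B, 1)]
      (dblCopy R 0 (CliffordAlgebra.involute (grassmannDeriv R X a)) * dblCopy R 1 (grassmannDeriv R Y b))) =
      -((Nat.factorial 4 : R) * kernel R a 4 ![X, A₀, A₁, A₂]) * ((Nat.factorial 2 : R) * kernel R b 2 ![Y, B]) := by
    intro X Y
    have h := constPart_iterDeriv_copyZero_copyOne R (m₀ := 3) (m₁ := 1) ![A₀, A₁, A₂] ![B]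
      (CliffordAlgebra.involute (grassmannDeriv R X a)) (grassmannDeriv R Y b)
    have e : iterDeriv R ![(A₀, (0 : Fin 2)), (A₁, 0), (A₂, 0), (B, 1)] =
        (iterDeriv R (fun i : Fin 1 => ((![B] : Fin 1 → Γ) i, (1 : Fin 2)))) ∘ₗ
          iterDeriv R (fun i : Fin 3 => ((![A₀, A₁, A₂] : Fin 3 → Γ) i, (0 : Fin 2))) := by
      apply LinearMap.ext
      intro P
      rw [LinearMap.comp_apply, iterDeriv_four_split,
        iterDeriv_succ_apply R (fun i : Fin 1 => ((![B] : Fin 1 → Γ) i, (1 : Fin 2))), iterDeriv_zero_apply,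
        iterDeriv_succ_succ_apply R (fun i : Fin 3 => ((![A₀, A₁, A₂] : Fin 3 → Γ) i, (0 : Fin 2))), iterDeriv_two, iterDeriv_two]
      have h1 : (fun j : Fin 1 => (fun i : Fin 3 => (((![A₀, A₁, A₂] : Fin 3 → Γ) i, (0 : Fin 2)) : Γ × Fin 2)) j.succ.succ) =
          ![(A₂, (0 : Fin 2))] := by funext j; fin_cases j; rfl
      rw [h1, iterDeriv_succ_apply, iterDeriv_zero_apply]
      rfl
    rw [e, LinearMap.comp_apply, h, constPart_iterDeriv_three_involute_deriv,
      show iterDeriv R ![B] (grassmannDeriv R Y b) = grassmannDeriv R B (grassmannDeriv R Y b) from by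
        rw [iterDeriv_succ_apply, iterDeriv_zero_apply]; rfl,
      constPart_deriv_deriv]
  simp only [key]
  rw [mul_neg, eq_neg_iff_add_eq_zero]
  simp only [Finset.mul_sum, ← Finset.sum_add_distrib]
  refine Finset.sum_eq_zero fun X _ => Finset.sum_eq_zero fun Y _ => ?_
  simp only [Nat.factorial]
  push_cast
  ring

/-- Colouring `0111` (leg `Z₀` on copy `0`): `= S13(Z₀ | Z₁Z₂Z₃)`. -/
theorem kernel_oneLine_colouring_0111 (C : Matrix Γ Γ R) (a b : GrassmannAlgebra R Γ) (Z : Fin 4 → Γ) :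
    kernel R (grassmannLaplacian R (crossCov R C) (dblCopy R 0 a * dblCopy R 1 b)) 4 (fun i => (Z i, (![0, 1, 1, 1] : Fin 4 → Fin 2) i)) =
      -(2 * ∑ X, ∑ Y, contr R C X Y * (kernel R a 2 ![X, Z 0] * kernel R b 4 ![Y, Z 1, Z 2, Z 3])) := by
  have hW : (fun i => (Z i, (![0, 1, 1, 1] : Fin 4 → Fin 2) i)) = ![(Z 0, (0 : Fin 2)), (Z 1, 1), (Z 2, 1), (Z 3, 1)] := by
    funext i; fin_cases i <;> rfl
  rw [hW, kernel_oneLine_sorted13]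

/-- Colouring `1011` (leg `Z₁` on copy `0`; a transposition): `= −S13(Z₁ | Z₀Z₂Z₃)`. -/
theorem kernel_oneLine_colouring_1011 (C : Matrix Γ Γ R) (a b : GrassmannAlgebra R Γ) (Z : Fin 4 → Γ) :
    kernel R (grassmannLaplacian R (crossCov R C) (dblCopy R 0 a * dblCopy R 1 b)) 4 (fun i => (Z i, (![1, 0, 1, 1] : Fin 4 → Fin 2) i)) =
      2 * ∑ X, ∑ Y, contr R C X Y * (kernel R a 2 ![X, Z 1] * kernel R b 4 ![Y, Z 0, Z 2, Z 3]) := by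
  let σ : Equiv.Perm (Fin 4) := ⟨![1, 0, 2, 3], ![1, 0, 2, 3], by decide, by decide⟩
  have hσ : Equiv.Perm.sign σ = -1 := by decide
  have hW : (fun i => (Z i, (![1, 0, 1, 1] : Fin 4 → Fin 2) i)) = ![(Z 1, (0 : Fin 2)), (Z 0, 1), (Z 2, 1), (Z 3, 1)] ∘ σ := by
    funext i; fin_cases i <;> rfl
  rw [hW, kernel_comp_perm, hσ, kernel_oneLine_sorted13]
  simp

/-- Colouring `1101` (leg `Z₂` on copy `0`; a 3-cycle): `= S13(Z₂ | Z₀Z₁Z₃)`. -/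
theorem kernel_oneLine_colouring_1101 (C : Matrix Γ Γ R) (a b : GrassmannAlgebra R Γ) (Z : Fin 4 → Γ) :
    kernel R (grassmannLaplacian R (crossCov R C) (dblCopy R 0 a * dblCopy R 1 b)) 4 (fun i => (Z i, (![1, 1, 0, 1] : Fin 4 → Fin 2) i)) =
      -(2 * ∑ X, ∑ Y, contr R C X Y * (kernel R a 2 ![X, Z 2] * kernel R b 4 ![Y, Z 0, Z 1, Z 3])) := by
  let σ : Equiv.Perm (Fin 4) := ⟨![1, 2, 0, 3], ![2, 0, 1, 3], by decide, by decide⟩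
  have hσ : Equiv.Perm.sign σ = 1 := by decide
  have hW : (fun i => (Z i, (![1, 1, 0, 1] : Fin 4 → Fin 2) i)) = ![(Z 2, (0 : Fin 2)), (Z 0, 1), (Z 1, 1), (Z 3, 1)] ∘ σ := by
    funext i; fin_cases i <;> rfl
  rw [hW, kernel_comp_perm, hσ, kernel_oneLine_sorted13]
  simp

/-- Colouring `1110` (leg `Z₃` on copy `0`; a 4-cycle): `= −S13(Z₃ | Z₀Z₁Z₂)`. -/
theorem kernel_oneLine_colouring_1110 (C : Matrix Γ Γ R) (a b : GrassmannAlgebra R Γ) (Z : Fin 4 → Γ) :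
    kernel R (grassmannLaplacian R (crossCov R C) (dblCopy R 0 a * dblCopy R 1 b)) 4 (fun i => (Z i, (![1, 1, 1, 0] : Fin 4 → Fin 2) i)) =
      2 * ∑ X, ∑ Y, contr R C X Y * (kernel R a 2 ![X, Z 3] * kernel R b 4 ![Y, Z 0, Z 1, Z 2]) := by
  let σ : Equiv.Perm (Fin 4) := ⟨![1, 2, 3, 0], ![3, 0, 1, 2], by decide, by decide⟩
  have hσ : Equiv.Perm.sign σ = -1 := by decide
  have hW : (fun i => (Z i, (![1, 1, 1, 0] : Fin 4 → Fin 2) i)) = ![(Z 3, (0 : Fin 2)), (Z 0, 1), (Z 1, 1), (Z 2, 1)] ∘ σ := by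
    funext i; fin_cases i <;> rfl
  rw [hW, kernel_comp_perm, hσ, kernel_oneLine_sorted13]
  simp

/-- Colouring `0001` (leg `Z₃` on copy `1`): `= S31(Z₀Z₁Z₂ | Z₃)`. -/
theorem kernel_oneLine_colouring_0001 (C : Matrix Γ Γ R) (a b : GrassmannAlgebra R Γ) (Z : Fin 4 → Γ) :
    kernel R (grassmannLaplacian R (crossCov R C) (dblCopy R 0 a * dblCopy R 1 b)) 4 (fun i => (Z i, (![0, 0, 0, 1] : Fin 4 → Fin 2) i)) =
      -(2 * ∑ X, ∑ Y, contr R C X Y * (kernel R a 4 ![X, Z 0, Z 1, Z 2] * kernel R b 2 ![Y, Z 3])) := by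
  have hW : (fun i => (Z i, (![0, 0, 0, 1] : Fin 4 → Fin 2) i)) = ![(Z 0, (0 : Fin 2)), (Z 1, 0), (Z 2, 0), (Z 3, 1)] := by
    funext i; fin_cases i <;> rfl
  rw [hW, kernel_oneLine_sorted31]

/-- Colouring `0010` (leg `Z₂` on copy `1`; a transposition): `= −S31(Z₀Z₁Z₃ | Z₂)`. -/
theorem kernel_oneLine_colouring_0010 (C : Matrix Γ Γ R) (a b : GrassmannAlgebra R Γ) (Z : Fin 4 → Γ) :
    kernel R (grassmannLaplacian R (crossCov R C) (dblCopy R 0 a * dblCopy R 1 b)) 4 (fun i => (Z i, (![0, 0, 1, 0] : Fin 4 → Fin 2) i)) =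
      2 * ∑ X, ∑ Y, contr R C X Y * (kernel R a 4 ![X, Z 0, Z 1, Z 3] * kernel R b 2 ![Y, Z 2]) := by
  let σ : Equiv.Perm (Fin 4) := ⟨![0, 1, 3, 2], ![0, 1, 3, 2], by decide, by decide⟩
  have hσ : Equiv.Perm.sign σ = -1 := by decide
  have hW : (fun i => (Z i, (![0, 0, 1, 0] : Fin 4 → Fin 2) i)) = ![(Z 0, (0 : Fin 2)), (Z 1, 0), (Z 3, 0), (Z 2, 1)] ∘ σ := by
    funext i; fin_cases i <;> rfl
  rw [hW, kernel_comp_perm, hσ, kernel_oneLine_sorted31]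
  simp

/-- Colouring `0100` (leg `Z₁` on copy `1`; a 3-cycle): `= S31(Z₀Z₂Z₃ | Z₁)`. -/
theorem kernel_oneLine_colouring_0100 (C : Matrix Γ Γ R) (a b : GrassmannAlgebra R Γ) (Z : Fin 4 → Γ) :
    kernel R (grassmannLaplacian R (crossCov R C) (dblCopy R 0 a * dblCopy R 1 b)) 4 (fun i => (Z i, (![0, 1, 0, 0] : Fin 4 → Fin 2) i)) =
      -(2 * ∑ X, ∑ Y, contr R C X Y * (kernel R a 4 ![X, Z 0, Z 2, Z 3] * kernel R b 2 ![Y, Z 1])) := by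
  let σ : Equiv.Perm (Fin 4) := ⟨![0, 3, 1, 2], ![0, 2, 3, 1], by decide, by decide⟩
  have hσ : Equiv.Perm.sign σ = 1 := by decide
  have hW : (fun i => (Z i, (![0, 1, 0, 0] : Fin 4 → Fin 2) i)) = ![(Z 0, (0 : Fin 2)), (Z 2, 0), (Z 3, 0), (Z 1, 1)] ∘ σ := by
    funext i; fin_cases i <;> rfl
  rw [hW, kernel_comp_perm, hσ, kernel_oneLine_sorted31]
  simp

/-- Colouring `1000` (leg `Z₀` on copy `1`; a 4-cycle): `= −S31(Z₁Z₂Z₃ | Z₀)`. -/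
theorem kernel_oneLine_colouring_1000 (C : Matrix Γ Γ R) (a b : GrassmannAlgebra R Γ) (Z : Fin 4 → Γ) :
    kernel R (grassmannLaplacian R (crossCov R C) (dblCopy R 0 a * dblCopy R 1 b)) 4 (fun i => (Z i, (![1, 0, 0, 0] : Fin 4 → Fin 2) i)) =
      2 * ∑ X, ∑ Y, contr R C X Y * (kernel R a 4 ![X, Z 1, Z 2, Z 3] * kernel R b 2 ![Y, Z 0]) := by
  let σ : Equiv.Perm (Fin 4) := ⟨![3, 0, 1, 2], ![1, 2, 3, 0], by decide, by decide⟩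
  have hσ : Equiv.Perm.sign σ = -1 := by decide
  have hW : (fun i => (Z i, (![1, 0, 0, 0] : Fin 4 → Fin 2) i)) = ![(Z 1, (0 : Fin 2)), (Z 2, 0), (Z 3, 0), (Z 0, 1)] ∘ σ := by
    funext i; fin_cases i <;> rfl
  rw [hW, kernel_comp_perm, hσ, kernel_oneLine_sorted31]
  simp

/-- **`kernel_dblFold_oneLine`** — the `4`-leg kernel of the folded one-line term (`b` even): the eight odd colourings. -/
theorem kernel_dblFold_oneLine (C : Matrix Γ Γ R) (a : GrassmannAlgebra R Γ) {b : GrassmannAlgebra R Γ} (hb : b ∈ evenOdd R 0) (Z : Fin 4 → Γ) :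
    kernel R (dblFold R (grassmannLaplacian R (crossCov R C) (dblCopy R 0 a * dblCopy R 1 b))) 4 Z =
      -(2 * ((∑ X, ∑ Y, contr R C X Y * (kernel R a 2 ![X, Z 0] * kernel R b 4 ![Y, Z 1, Z 2, Z 3])) -
              (∑ X, ∑ Y, contr R C X Y * (kernel R a 2 ![X, Z 1] * kernel R b 4 ![Y, Z 0, Z 2, Z 3])) +
              (∑ X, ∑ Y, contr R C X Y * (kernel R a 2 ![X, Z 2] * kernel R b 4 ![Y, Z 0, Z 1, Z 3])) -
              (∑ X, ∑ Y, contr R C X Y * (kernel R a 2 ![X, Z 3] * kernel R b 4 ![Y, Z 0, Z 1, Z 2])))) -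
        2 * ((∑ X, ∑ Y, contr R C X Y * (kernel R a 4 ![X, Z 0, Z 1, Z 2] * kernel R b 2 ![Y, Z 3])) -
              (∑ X, ∑ Y, contr R C X Y * (kernel R a 4 ![X, Z 0, Z 1, Z 3] * kernel R b 2 ![Y, Z 2])) +
              (∑ X, ∑ Y, contr R C X Y * (kernel R a 4 ![X, Z 0, Z 2, Z 3] * kernel R b 2 ![Y, Z 1])) -
              (∑ X, ∑ Y, contr R C X Y * (kernel R a 4 ![X, Z 1, Z 2, Z 3] * kernel R b 2 ![Y, Z 0]))) := by
  have heven : ∀ s : Fin 4 → Fin 2, (∏ i, (if ((fun i => (Z i, s i)) i).2 = 1 then (-1 : R) else 1)) = 1 →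
      kernel R (grassmannLaplacian R (crossCov R C) (dblCopy R 0 a * dblCopy R 1 b)) 4 (fun i => (Z i, s i)) = 0 :=
    fun s hs => kernel_oneLine_eq_zero_of_even R C a hb _ hs
  rw [kernel_dblFold, sum_colourings_four, kernel_oneLine_colouring_0111, kernel_oneLine_colouring_1011, kernel_oneLine_colouring_1101,
    kernel_oneLine_colouring_1110, kernel_oneLine_colouring_0001, kernel_oneLine_colouring_0010, kernel_oneLine_colouring_0100,
    kernel_oneLine_colouring_1000,
    heven ![0, 0, 0, 0] (by simp [Fin.prod_univ_four]), heven ![0, 0, 1, 1] (by simp [Fin.prod_univ_four]),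
    heven ![0, 1, 0, 1] (by simp [Fin.prod_univ_four]), heven ![0, 1, 1, 0] (by simp [Fin.prod_univ_four]),
    heven ![1, 0, 0, 1] (by simp [Fin.prod_univ_four]), heven ![1, 0, 1, 0] (by simp [Fin.prod_univ_four]),
    heven ![1, 1, 0, 0] (by simp [Fin.prod_univ_four]), heven ![1, 1, 1, 1] (by simp [Fin.prod_univ_four])]
  ring

omit [DecidableEq Γ] in
/-- Exchanging the copies of the SAME vertex `w` in a one-line sum flips its sign (ONE antisymmetric `contr`):
`Σ contr C X Y · kernel w 4 (X,A) · kernel w 2 (Y,B) = −Σ contr C X Y · kernel w 2 (X,B) · kernel w 4 (Y,A)`. -/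
theorem oneLineSum_swap (C : Matrix Γ Γ R) (w : GrassmannAlgebra R Γ) (A : Fin 3 → Γ) (B : Γ) :
    (∑ X, ∑ Y, contr R C X Y * (kernel R w 4 (Matrix.vecCons X A) * kernel R w 2 ![Y, B])) =
      -∑ X, ∑ Y, contr R C X Y * (kernel R w 2 ![X, B] * kernel R w 4 (Matrix.vecCons Y A)) := by
  rw [Finset.sum_comm, ← Finset.sum_neg_distrib]
  refine Finset.sum_congr rfl fun X _ => ?_
  rw [← Finset.sum_neg_distrib]
  refine Finset.sum_congr rfl fun Y _ => ?_
  rw [contr_swap R C Y X]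
  ring

/-- **`kernel_dblFold_oneLine_self`** — for two copies of the same even vertex `w`:
`kernel (dblFold(Δ_×(C)(w⁰w¹))) 4 Z = 4·(−T₀ + T₁ − T₂ + T₃)`, `T_i = Σ_{X,Y} contr C X Y · kernel w 2 (X, Z_i) · kernel w 4 (Y, Z without Z_i)`. -/
theorem kernel_dblFold_oneLine_self (C : Matrix Γ Γ R) {w : GrassmannAlgebra R Γ} (hw : w ∈ evenOdd R 0) (Z : Fin 4 → Γ) :
    kernel R (dblFold R (grassmannLaplacian R (crossCov R C) (dblCopy R 0 w * dblCopy R 1 w))) 4 Z =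
      4 * (-(∑ X, ∑ Y, contr R C X Y * (kernel R w 2 ![X, Z 0] * kernel R w 4 ![Y, Z 1, Z 2, Z 3])) +
            (∑ X, ∑ Y, contr R C X Y * (kernel R w 2 ![X, Z 1] * kernel R w 4 ![Y, Z 0, Z 2, Z 3])) -
            (∑ X, ∑ Y, contr R C X Y * (kernel R w 2 ![X, Z 2] * kernel R w 4 ![Y, Z 0, Z 1, Z 3])) +
            (∑ X, ∑ Y, contr R C X Y * (kernel R w 2 ![X, Z 3] * kernel R w 4 ![Y, Z 0, Z 1, Z 2]))) := by
  rw [kernel_dblFold_oneLine R C w hw Z, oneLineSum_swap R C w ![Z 0, Z 1, Z 2] (Z 3), oneLineSum_swap R C w ![Z 0, Z 1, Z 3] (Z 2),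
    oneLineSum_swap R C w ![Z 0, Z 2, Z 3] (Z 1), oneLineSum_swap R C w ![Z 1, Z 2, Z 3] (Z 0)]
  ring

end Generic

end Summit.HubbardSuperconductivity.HubbardSuperconductivity.Theorems.KLRegimeWick

end
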